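import Summits.HodgeConjecture.HodgeConjecture.Theorems.PadicSemiregularLiftHodgeFermatVarietiesPQTwinFibre

/-!
# Level `pq` WITHOUT `p + 2 < q`, IV — the two remaining entries are of level `q`; S14 classification `pqClassificationT` under `5 ≤ p < q`, `11 ≤ q`

Part 4 of 5 (Sketch step 2 §1 (II), ll. 637–843): `pair_level_q_pqT` (the two non-unit entries are of level `q`), `casts_pair_eqT` (their reductions are
`b₁` and `−p b₁`), and **`pqClassificationT`**: for primes `5 ≤ p < q`, `11 ≤ q`, every Hodge multiset of `p + 1` elements of `ℤ/pq` is a sum of pairs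
`{a, −a}` (`a ≠ 0`) or Aoki's standard multiset `σ_{p,a} = {a + i q : i < p} + {−p a}` of a unit `a`. Covers the twin levels `p(p+2)`, `p ≥ 11`
(`X¹⁰₁₄₃`, `X¹⁶₃₂₃`, `X²⁸₈₉₉`, …) — the kernel form of THEOREM P1AF-1 of memo ROUTE-P1AF at `ℓ = p + 1`.

PROVENANCE. Cell hodge-nonav (HUMAN RULING D-0038), planner seat p1 g33: chapter ROUTE-P1AF addenda ADD2 ∕ ADD3 (memos `HOME/memos/ROUTE-P1AF-ADD2.md`
d3af0b1bf97b24f6, `…-ADD3.md` 5042c485c3dfa6c1; referee PASS 0∕0: ref g51 REF-P1AF-ADD2.md, REF-P1AF-ADD3.md 5111ed97ffe1fe84), frozen Sketch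
`HOME/p1/route/Sketch_P1AF_TWIN_ALL_g33.lean` (sha16 48c9088b216d60cb, 1063 lines, namespace `HodgeNonAV.P1AF.Twin`, farm rc 0 / 0 sorries / axioms
{propext, Classical.choice, Quot.sound}; re-elaborated 2026-08-28), split into five tree modules `…PQTwinCounting` → `…PQTwinStructure` → `…PQTwinFibre` →
`…PQTwinClassification` → `…PQTwinPayoff` by planner p1 g34 (landing kit HOME/p1/landing/); proof bodies verbatim; docstrings reworded per referee riders
N-ADD2-1 ∕ N-ADD3-1 (hypotheses read `5 ≤ p`, `p < q`, `11 ≤ q` as the theorems carry them; no cell tags; Aoki cites are METHOD attributions — the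
statements at the twin levels are not in print). A parallel `T`-family rather than a weakening of the tree's `PQFibre ∕ PQClassification ∕ PQPayoff`
hypothesis `p + 2 < q`, because Theorems files are append-only; an operator refactor may later merge the two spellings.
Extends line `cancel-by-any-claim-lattice` of crux `HodgeFermatVarieties` (route `PadicSemiregularLift`): land with `--supports stmt-HodgeConjecture-1334`
(or `--supports stmt-HodgeConjecture-19652 --as helper`). No instance, no new notation (Part 5's eight `local notation3` are the line's, verbatim from
`Theorems/PadicSemiregularLiftHodgeFermatVarietiesPQPayoff`), no sorry, no new axiom.
HONEST SCOPE: combinatorics of Hodge `(p+1)`-multisets of `ℤ/pq` and the HC pay-off for the Fermat `(p−1)`-folds `X^{p−1}_{pq}` MODULO the line's named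
facts (S0) and stub statements (S2↑, S2↓, S3a, S5) — exactly the hypotheses of the tree's `PQ.hodgeConjectureFor_pq`; Fermat varieties are dominated by
abelian motives, so this is inside the known (AV) region of the summit; NOTHING here proves the Hodge conjecture.
References (method): N. Aoki, Math. Ann. 266 (1983) Thm A′ (§7), Prop. 2.2 [cite: Aoki1983, Thm. A]; N. Aoki, J. Math. Soc. Japan 39 (1987) §1, Thm 2-1
[cite: Aoki1987, Thm. 2-1]; T. Shioda, Math. Ann. 245 (1979) [cite: Shioda1979PJA, Thm. I].
-/

set_option linter.dupNamespace false
set_option linter.unusedVariables false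

noncomputable section

namespace Summit.HodgeConjecture.HodgeConjecture.Theorems.CancelByAnyClaimLattice.PQTwin

open Finset
open CategoryTheory AlgebraicGeometry
open Literature.AlgebraicGeometry Literature.AlgebraicGeometry.Motives Literature.AlgebraicTopology.SingularHomology
open Literature.AlgebraicGeometry.HodgeTheory Literature.AlgebraicGeometry.HodgeTheory.FermatCharacter
open Summit.HodgeConjecture.HodgeConjecture.Theorems.CancelByAnyClaimLattice.FiveQ
open Summit.HodgeConjecture.HodgeConjecture.Theorems.CancelByAnyClaimLattice.PQ
open Summit.HodgeConjecture.HodgeConjecture.Theorems.CancelByAnyClaimLattice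

section LevelPQ

variable {p q : ℕ} [Fact p.Prime] [Fact q.Prime]

/-- **THE TWO REMAINING ENTRIES ARE OF LEVEL `q`**: `y ≡ z ≡ 0 (mod p)`, `ȳ, z̄ ≠ 0`, `ȳ + z̄ = (1 - p) b₁`
(method after [cite: Aoki1983, Thm. A′ (§7)]; the statement at `p < q`, `11 ≤ q` is the line's ∕ cell hodge-nonav's, not in print). -/
theorem pair_level_q_pqT : ∀ {p q : ℕ} [Fact p.Prime] [Fact q.Prime], 5 ≤ p → p < q → 11 ≤ q →
    ∀ {s : Multiset (ZMod (p * q))}, IsHodgeMultiset s →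
    ∀ {b₁ : (ZMod q)ˣ} {y z : ZMod (p * q)},
    s = (univ.filter fun x : (ZMod (p * q))ˣ ↦ ZMod.unitsMap (dvd_mul_left q p) x = b₁).val.map
      (fun x : (ZMod (p * q))ˣ ↦ (x : ZMod (p * q))) + {y, z} →
    (∀ x : (ZMod (p * q))ˣ, ZMod.unitsMap (dvd_mul_left q p) x ≠ b₁ → ZMod.unitsMap (dvd_mul_left q p) x ≠ -b₁ →
      Multiset.count (x : ZMod (p * q)) s = Multiset.count (-(x : ZMod (p * q))) s) →
    ZMod.castHom (dvd_mul_right p q) (ZMod p) y = 0 ∧ ZMod.castHom (dvd_mul_right p q) (ZMod p) z = 0 ∧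
      ZMod.castHom (dvd_mul_left q p) (ZMod q) y ≠ 0 ∧ ZMod.castHom (dvd_mul_left q p) (ZMod q) z ≠ 0 ∧
      ZMod.castHom (dvd_mul_left q p) (ZMod q) y + ZMod.castHom (dvd_mul_left q p) (ZMod q) z =
        (1 - (p : ZMod q)) * (b₁ : ZMod q) := by
  intro p q _ _ hp hpq1 hq s hs b₁ y z hsyz hoff
  classical
  have hpq : p ≠ q := by omega
  -- the sum of `s` vanishes: `y + z = -Σ F`
  have hsum0 : ((univ.filter fun x : (ZMod (p * q))ˣ ↦ ZMod.unitsMap (dvd_mul_left q p) x = b₁).val.map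
      (fun x : (ZMod (p * q))ˣ ↦ (x : ZMod (p * q)))).sum + (y + z) = 0 := by
    have := hs.1.2
    rw [hsyz, Multiset.sum_add] at this
    simpa using this
  obtain ⟨hFp, hFq⟩ := casts_sum_fibre hp hpq b₁
  have hsump : ZMod.castHom (dvd_mul_right p q) (ZMod p) y + ZMod.castHom (dvd_mul_right p q) (ZMod p) z = 0 := by
    have := congrArg (ZMod.castHom (dvd_mul_right p q) (ZMod p)) hsum0
    rw [map_add, map_add, hFp, map_zero, zero_add] at this
    exact this
  have hsumq : ZMod.castHom (dvd_mul_left q p) (ZMod q) y + ZMod.castHom (dvd_mul_left q p) (ZMod q) z =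
      (1 - (p : ZMod q)) * (b₁ : ZMod q) := by
    have := congrArg (ZMod.castHom (dvd_mul_left q p) (ZMod q)) hsum0
    rw [map_add, map_add, hFq, map_zero] at this
    linear_combination this
  have hs0 := hs.1.1
  have hy : ¬ IsUnit y := not_isUnit_of_pairT hp hpq1 hq hs0 hsyz hoff hsump hsumq
  have hsyz' : s = (univ.filter fun x : (ZMod (p * q))ˣ ↦ ZMod.unitsMap (dvd_mul_left q p) x = b₁).val.map
      (fun x : (ZMod (p * q))ˣ ↦ (x : ZMod (p * q))) + {z, y} := by rw [hsyz, Multiset.pair_comm]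
  have hz : ¬ IsUnit z := not_isUnit_of_pairT hp hpq1 hq hs0 hsyz' hoff (by rw [add_comm]; exact hsump)
    (by rw [add_comm]; exact hsumq)
  have hy0 : y ≠ 0 := hs0 y (by rw [hsyz]; simp)
  have hz0 : z ≠ 0 := hs0 z (by rw [hsyz]; simp)
  -- neither is of level `p`
  rcases trichotomy hpq hy0 with hyu | ⟨hyp, hyq⟩ | ⟨hyp, hyq⟩
  · exact absurd hyu hy
  · rcases trichotomy hpq hz0 with hzu | ⟨hzp, hzq⟩ | ⟨hzp, hzq⟩
    · exact absurd hzu hz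
    · exact ⟨hyp, hzp, hyq, hzq, hsumq⟩
    · -- `z` level `p`: then `y ≡ -z ≢ 0 (p)` — but `y ≡ 0 (p)`
      exfalso
      rw [hyp, zero_add] at hsump
      exact hzp hsump
  · exfalso
    rcases trichotomy hpq hz0 with hzu | ⟨hzp, -⟩ | ⟨-, hzq⟩
    · exact absurd hzu hz
    · rw [hzp, add_zero] at hsump; exact hyp hsump
    · -- both of level `p`: `0 = (1 - p) b₁`
      rw [hyq, hzq, zero_add] at hsumq
      exact coef_mul_ne_zero (cast_sub_one_ne_zeroT hp hpq1) b₁ (by linear_combination hsumq)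


/-! ### §1 (II) identifies the two level-`q` entries -/

/-- **The reductions of the two level-`q` entries are `b₁` and `-p b₁`** (up to order): the relation (II)
for `s = F + {y, z}` reads `(p - 1)((χ(p) - 1)χ(b₁) + χ(ȳ) + χ(z̄)) = 0` for every odd `χ` mod `q`, so
`Φ = 𝟙_{p b₁} - 𝟙_{b₁} + 𝟙_ȳ + 𝟙_z̄` is even; evaluating at `±b₁` gives `ȳ = b₁` or `z̄ = b₁`.
[cite: Aoki1983, Prop. 2.2] -/
theorem casts_pair_eqT (hp : 5 ≤ p) (hpq1 : p < q) (hq : 11 ≤ q) {s : Multiset (ZMod (p * q))} (hs : IsHodgeMultiset s)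
    {b₁ : (ZMod q)ˣ} {y z : ZMod (p * q)}
    (hsyz : s = (univ.filter fun x : (ZMod (p * q))ˣ ↦ ZMod.unitsMap (dvd_mul_left q p) x = b₁).val.map
      (fun x : (ZMod (p * q))ˣ ↦ (x : ZMod (p * q))) + {y, z})
    (hy : ¬ IsUnit y) (hz : ¬ IsUnit z) :
    ZMod.castHom (dvd_mul_left q p) (ZMod q) y = b₁ ∨ ZMod.castHom (dvd_mul_left q p) (ZMod q) z = b₁ := by
  classical
  have hpq : p ≠ q := by omega
  set yq := ZMod.castHom (dvd_mul_left q p) (ZMod q) y with hyq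
  set zq := ZMod.castHom (dvd_mul_left q p) (ZMod q) z with hzq
  by_contra hnot
  push Not at hnot
  obtain ⟨hyb, hzb⟩ := hnot
  -- `Φ` is orthogonal to the odd characters mod `q`
  set Φ : ZMod q → ℂ := fun t ↦ (if t = (p : ZMod q) * (b₁ : ZMod q) then 1 else 0) -
    (if t = (b₁ : ZMod q) then 1 else 0) + (if t = yq then 1 else 0) + (if t = zq then 1 else 0) with hΦ
  have horth : ∀ ψ : DirichletCharacter ℂ q, ψ (-1) = -1 → ∑ t : ZMod q, Φ t * ψ t = 0 := by
    intro ψ hψ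
    have hΦsum : ∑ t : ZMod q, Φ t * ψ t =
        ψ ((p : ZMod q) * (b₁ : ZMod q)) - ψ (b₁ : ZMod q) + ψ yq + ψ zq := by
      simp only [hΦ, sub_mul, add_mul, ite_mul, one_mul, zero_mul, Finset.sum_add_distrib,
        Finset.sum_sub_distrib, Finset.sum_ite_eq', Finset.mem_univ, if_true]
    rw [hΦsum]
    -- (II) for `χ = ψ⁻¹` on `s = F + {y, z}`
    have h2 := stub_twoPrime_level_right p q hpq s hs ψ⁻¹ (inv_neg_one_of_odd hψ)
      (ne_one_of_odd (inv_neg_one_of_odd hψ))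
    rw [hsyz, Multiset.map_add, Multiset.sum_add] at h2
    -- the fibre part
    have hF : ((univ.filter fun x : (ZMod (p * q))ˣ ↦ ZMod.unitsMap (dvd_mul_left q p) x = b₁).val.map
        (fun x : (ZMod (p * q))ˣ ↦ (x : ZMod (p * q)))).map (fun x ↦
          (if IsUnit x then (1 - ψ⁻¹ ((p : ℕ) : ZMod q)) else ((p - 1 : ℕ) : ℂ) * ψ⁻¹ ((p : ℕ) : ZMod q)) *
            (ψ⁻¹ (ZMod.castHom (dvd_mul_left q p) (ZMod q) x))⁻¹) =
        ((univ.filter fun x : (ZMod (p * q))ˣ ↦ ZMod.unitsMap (dvd_mul_left q p) x = b₁).val.map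
          fun _ ↦ (1 - ψ⁻¹ ((p : ℕ) : ZMod q)) * ψ (b₁ : ZMod q)) := by
      rw [Multiset.map_map]
      refine Multiset.map_congr rfl fun x hx ↦ ?_
      simp only [Finset.mem_val, mem_filter, mem_univ, true_and] at hx
      rw [Function.comp_apply, if_pos (Units.isUnit x), inv_inv_apply, ← coe_unitsMap, hx]
    have hFsum : (((univ.filter fun x : (ZMod (p * q))ˣ ↦ ZMod.unitsMap (dvd_mul_left q p) x = b₁).val.map
          fun _ ↦ (1 - ψ⁻¹ ((p : ℕ) : ZMod q)) * ψ (b₁ : ZMod q))).sum =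
        ((p - 1 : ℕ) : ℂ) * ((1 - ψ⁻¹ ((p : ℕ) : ZMod q)) * ψ (b₁ : ZMod q)) := by
      rw [Multiset.map_const', Multiset.sum_replicate, Finset.card_val, card_fibre hpq b₁, nsmul_eq_mul]
    -- the pair part
    have hP : (({y, z} : Multiset (ZMod (p * q))).map fun x ↦
        (if IsUnit x then (1 - ψ⁻¹ ((p : ℕ) : ZMod q)) else ((p - 1 : ℕ) : ℂ) * ψ⁻¹ ((p : ℕ) : ZMod q)) *
          (ψ⁻¹ (ZMod.castHom (dvd_mul_left q p) (ZMod q) x))⁻¹).sum =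
        ((p - 1 : ℕ) : ℂ) * ψ⁻¹ ((p : ℕ) : ZMod q) * (ψ yq + ψ zq) := by
      simp only [Multiset.insert_eq_cons, Multiset.map_cons, Multiset.map_singleton, Multiset.sum_cons,
        Multiset.sum_singleton, if_neg hy, if_neg hz, inv_inv_apply]
      rw [← hyq, ← hzq]
      ring
    rw [hF, hFsum, hP] at h2
    -- `ψ⁻¹(p) = ψ(p)⁻¹` with `ψ(p) ≠ 0`, and `p - 1 ≠ 0`
    have hpu : IsUnit ((p : ℕ) : ZMod q) := by
      rw [ZMod.isUnit_prime_iff_not_dvd (Fact.out : p.Prime)]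
      intro h
      exact hpq ((Nat.prime_dvd_prime_iff_eq (Fact.out : p.Prime) Fact.out).mp h)
    have hψp : ψ ((p : ℕ) : ZMod q) ≠ 0 := (hpu.map ψ).ne_zero
    have hp1 : ((p - 1 : ℕ) : ℂ) ≠ 0 := by
      have : (p - 1 : ℕ) ≠ 0 := by omega
      exact_mod_cast this
    rw [MulChar.inv_apply_eq_inv'] at h2
    have key : (ψ ((p : ℕ) : ZMod q) - 1) * ψ (b₁ : ZMod q) + ψ yq + ψ zq = 0 := by
      have h3 : ((p - 1 : ℕ) : ℂ) * ((ψ ((p : ℕ) : ZMod q) - 1) * ψ (b₁ : ZMod q) + ψ yq + ψ zq) =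
          ψ ((p : ℕ) : ZMod q) * (((p - 1 : ℕ) : ℂ) * ((1 - (ψ ((p : ℕ) : ZMod q))⁻¹) * ψ (b₁ : ZMod q)) +
            ((p - 1 : ℕ) : ℂ) * (ψ ((p : ℕ) : ZMod q))⁻¹ * (ψ yq + ψ zq)) := by
        field_simp
        ring
      rw [h2, mul_zero] at h3
      exact (mul_eq_zero.mp h3).resolve_left hp1
    rw [map_mul]
    linear_combination key
  -- evenness of `Φ` at `b₁`
  have heven := even_of_orthogonal_odd Φ horth b₁
  -- evaluate both sides: `(p - 1) b₁, (p + 1) b₁, 2 b₁ ≠ 0`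
  have h4 : (b₁ : ZMod q) ≠ (p : ZMod q) * (b₁ : ZMod q) := fun h ↦
    coef_mul_ne_zero (cast_sub_one_ne_zeroT hp hpq1) b₁ (by linear_combination -h)
  have h6 : -(b₁ : ZMod q) ≠ (p : ZMod q) * (b₁ : ZMod q) := fun h ↦
    coef_mul_ne_zero (cast_add_one_ne_zeroT hp hpq1) b₁ (by linear_combination -h)
  have h2' : -(b₁ : ZMod q) ≠ (b₁ : ZMod q) := fun h ↦
    coef_mul_ne_zero (two_ne_zeroT hp hpq1) b₁ (by linear_combination -h)
  have hL : Φ (b₁ : ZMod q) = -1 := by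
    simp only [hΦ, if_neg h4, if_neg (Ne.symm hyb), if_neg (Ne.symm hzb)]
    norm_num
  have hR : Φ (-(b₁ : ZMod q)) =
      (if -(b₁ : ZMod q) = yq then 1 else 0) + (if -(b₁ : ZMod q) = zq then 1 else 0) := by
    simp only [hΦ, if_neg h6, if_neg h2']
    norm_num
  rw [hL, hR] at heven
  split_ifs at heven <;> norm_num at heven


/-- **S14 — CLASSIFICATION OF THE HODGE `(p+1)`-TUPLES OF LEVEL `pq`** (primes `5 ≤ p < q`, `11 ≤ q`):
every Hodge multiset of `p + 1` elements of `ℤ/pq` is a sum of pairs `{a, -a}` (`a ≠ 0`), or Aoki's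
standard multiset `σ_{p,a} = {a + i q : i < p} + {-p a}` of a unit `a` (in the spelling of the line's
printed supply). (method after [cite: Aoki1983, Thm. A′ (§7) and Prop. 2.2] [cite: Aoki1987, §1 p. 387]; the statement at `p < q`, `11 ≤ q` is the line's ∕ cell hodge-nonav's, not in print) -/
theorem pqClassificationT :
    ∀ (p q : ℕ) [Fact p.Prime] [Fact q.Prime], 5 ≤ p → p < q → 11 ≤ q →
      ∀ s : Multiset (ZMod (p * q)), IsHodgeMultiset s → Multiset.card s = p + 1 →
        (∃ Q : Multiset (ZMod (p * q)), (∀ a ∈ Q, a ≠ 0) ∧ s = Q + Q.map (fun a ↦ -a)) ∨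
        ∃ a : ZMod (p * q), IsUnit a ∧
          s = (Multiset.range p).map (fun i : ℕ ↦ a + (i : ZMod (p * q)) * ((p * q / p : ℕ) : ZMod (p * q))) +
            {-((p : ZMod (p * q)) * a)} := by
  intro p q _ _ hp hpq1 hq s hs h6
  classical
  have hpq : p ≠ q := by omega
  rcases structure_units_pq' hp hpq1 hq hs h6 with hsym | ⟨b₁, hocc, hoff⟩
  · exact Or.inl (exists_pairs_of_symmetric_pq (by omega) (by omega) hpq hs hsym)
  right
  obtain ⟨y₀, z₀, hsyz₀⟩ := exists_eq_fibre_add_pair hpq h6 hocc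
  obtain ⟨hyp₀, hzp₀, hyq₀, hzq₀, hsum₀⟩ := pair_level_q_pqT hp hpq1 hq hs hsyz₀ hoff
  -- orient the pair so that `ȳ = b₁`
  obtain ⟨y, z, hsyz, hyp, hzp, hyq, hzq, hsum, hyb⟩ : ∃ y z : ZMod (p * q),
      s = (univ.filter fun x : (ZMod (p * q))ˣ ↦ ZMod.unitsMap (dvd_mul_left q p) x = b₁).val.map
        (fun x : (ZMod (p * q))ˣ ↦ (x : ZMod (p * q))) + {y, z} ∧
      ZMod.castHom (dvd_mul_right p q) (ZMod p) y = 0 ∧ ZMod.castHom (dvd_mul_right p q) (ZMod p) z = 0 ∧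
      ZMod.castHom (dvd_mul_left q p) (ZMod q) y ≠ 0 ∧ ZMod.castHom (dvd_mul_left q p) (ZMod q) z ≠ 0 ∧
      ZMod.castHom (dvd_mul_left q p) (ZMod q) y + ZMod.castHom (dvd_mul_left q p) (ZMod q) z =
        (1 - (p : ZMod q)) * (b₁ : ZMod q) ∧
      ZMod.castHom (dvd_mul_left q p) (ZMod q) y = b₁ := by
    have hyu : ¬ IsUnit y₀ := fun h ↦ cast_ne_zero_of_isUnit' h hyp₀
    have hzu : ¬ IsUnit z₀ := fun h ↦ cast_ne_zero_of_isUnit' h hzp₀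
    rcases casts_pair_eqT hp hpq1 hq hs hsyz₀ hyu hzu with h | h
    · exact ⟨y₀, z₀, hsyz₀, hyp₀, hzp₀, hyq₀, hzq₀, hsum₀, h⟩
    · refine ⟨z₀, y₀, by rw [hsyz₀, Multiset.pair_comm], hzp₀, hyp₀, hzq₀, hyq₀,
        by rw [add_comm]; exact hsum₀, h⟩
  have hzb : ZMod.castHom (dvd_mul_left q p) (ZMod q) z = -((p : ZMod q) * (b₁ : ZMod q)) := by
    rw [hyb] at hsum; linear_combination hsum
  -- a unit `a` of the fibre
  obtain ⟨a, -, ha⟩ := exists_unit_of_unitsMap hpq (1 : (ZMod p)ˣ) b₁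
  refine ⟨a, Units.isUnit a, ?_⟩
  rw [← fibre_add_point_eq_range_map hpq a ha hyp hyb, hsyz, add_assoc]
  congr 1
  -- `{y, z} = {y} + {-(p a)}`: `z = -p a` by its two reductions
  have hz : z = -((p : ZMod (p * q)) * a) := by
    refine eq_of_casts_eq hpq ?_ ?_
    · rw [hzp, map_neg, map_mul, map_natCast, ZMod.natCast_self, zero_mul, neg_zero]
    · rw [hzb, map_neg, map_mul, map_natCast, ← coe_unitsMap, ha]
  rw [hz, Multiset.insert_eq_cons, Multiset.singleton_add]


end LevelPQ

end Summit.HodgeConjecture.HodgeConjecture.Theorems.CancelByAnyClaimLattice.PQTwin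

end
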